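/-
Copyright (c) 2026. All rights reserved.
Released under Apache 2.0 license as described in the file LICENSE.
Authors: abc-iut cell, prover seat abc-iut-f-102 (F fact-proving wave, gen 3), porting abc-iut-f-101's move system.
-/
import Literature.AnabelianGeometry.AbsoluteAnabelian.DiagramChainFamilies
import Literature.AnabelianGeometry.AbsoluteAnabelian.LogFrobeniusObservablesOfIotaSquare
import HarnessLib

/-!
# [AbsTopIII] Cor 5.5 (iii)/(v): the `ι⊞`-move system on the paths of `D•⊢` into `𝒩⊞_v` (THEOREM B, toolkit 1/4)

S. Mochizuki, *Topics in absolute anabelian geometry III: global reconstruction algorithms*,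
J. Math. Sci. Univ. Tokyo 22 (2015) 939–1156 [MochizukiAbsTopIII2015]; locators `p.N` = pages of the author's
manuscript (`paper:url-5493eb38cbb7`), read on the page: Def 5.4 (iii) p. 126, (v) p. 127, (vii) p. 128 (the graphs
`Γ⃗^log_v` and the `ι⊞_{v,ε}`), Cor 5.5 (iii) p. 131 (the observables `S_log⊞`), §0 p. 26 / Def 3.5 (ii) p. 75
(saturated sets; families of homotopies).

PURPOSE.  abc-iut-f-101's `LogFrobeniusObservablesMoves` / `LogFrobeniusObservablesOfIotaSquare` build the observable
`S_log⊞_v` on the PRESENTATION `D•_{≤2} ∪ {𝒩⊞_v}` from commuting `ι⊞`-squares (`IotaSquaresCommute`).  THEOREM B of this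
lineage (a family of homotopies on the WHOLE of `D•⊢` realising the cores of Cor 5.5 (i) and the observables of Cor 5.5
(iii) — F-0159 `RealisesCor55Families` — from interface-level conditions) needs the same move system on the paths of
`Γ⃗_{D•⊢}` itself into the vertex `𝒩⊞_v` (which, unlike the observation vertex of the presentation, HAS outgoing arrows,
so f-101's `chainFamily` does not apply verbatim; the relative-lift constructor `relFamily` of
`DiagramRelativeFamilies.lean` will).  This file is that port, over the generic `Move`/`Chain` of
`DiagramChainFamilies.lean`:

* the printed generator pairs as paths of `Γ⃗_{D•⊢}`: `([λ⊞_{ν₁}], [λ⊞_{ν₂}])` (`LGen.pre`) and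
  `([λ⊞_{sl}]∘[id_⋎]∘[log], [λ⊞_{ν₂}]∘[id_{⋎+1}])` (`LGen.post`), with homotopies `ι⊞_{v,ε}` (`lgenHom`);
* a weight on paths (`DVertex.pathWt`, from f-101's `DEdge.wt`) strictly lowered by every move (termination);
* unique decomposition of the paths into `𝒩⊞_v`;
* COHERENCE (`lchain_hom_eq`): if the `ι⊞`-squares of `Γ⃗^log_v` commute, any two chains of moves between the same two
  paths into `𝒩⊞_v` have the same homotopy (induction on the weight; the only fork is the nonarchimedean square of
  Def 5.4 (iii), closed by `moveHom_square`) — f-101's `chain_hom_eq_of_iotaSquaresCommute`, same proof.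

Pure bookkeeping over the interface `LogFrobeniusSetting`; `IotaSquaresCommute` is a HYPOTHESIS where used; no claim
of the paper is asserted.  Refereed pre-IUT material; nothing here bears on [IUTchIII] Cor. 3.12; typed ≠ proved.
-/

set_option autoImplicit false

universe u

open CategoryTheory Quiver

namespace Literature.AnabelianGeometry.AbsoluteAnabelian

variable {Vmod : Type u} {isArc : Vmod → Bool}

/-! ## A weight on the paths of `Γ⃗_{D•⊢}` -/

namespace DVertex

/-- The weight of a path of `Γ⃗_{D•⊢}`: the sum of abc-iut-f-101's arrow weights `DEdge.wt` (`3` for `log`, the rank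
of `ν` for `λ⊞_{v,ν}`, `0` otherwise). [cite: MochizukiAbsTopIII2015, Cor 5.5 (iii) p. 131] -/
def pathWt {a : DVertex Vmod isArc} : {b : DVertex Vmod isArc} → Path a b → ℕ
  | _, Path.nil => 0
  | _, Path.cons p e => pathWt p + DEdge.wt e

/-- The weight is additive along composition of paths. [cite: MochizukiAbsTopIII2015, Cor 5.5 (iii) p. 131] -/
theorem pathWt_comp {a b c : DVertex Vmod isArc} (r : Path a b) :
    ∀ (p : Path b c), pathWt (r.comp p) = pathWt r + pathWt p
  | Path.nil => rfl
  | Path.cons p e => by rw [Path.comp_cons, pathWt, pathWt, pathWt_comp r p, Nat.add_assoc]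

end DVertex

namespace LogFrobeniusSetting

variable (L : LogFrobeniusSetting Vmod isArc) (v : Vmod)

/-! ## The printed paths into `𝒩⊞_v`, as paths of `Γ⃗_{D•⊢}` -/

/-- the path `[λ⊞_{v,ν}]` of length 1 from `□` to `𝒩⊞_v` in `Γ⃗_{D•⊢}`. [cite: MochizukiAbsTopIII2015, Cor 5.5 (iii) p. 131] -/
def lamP (ν : LogVertex (isArc v)) (hν : ν.isPostLog = false) :
    Path (DVertex.core : DVertex Vmod isArc) (.nplus v) :=
  Path.nil.cons (DEdge.lam v ν hν)

/-- the path `[λ⊞_{v,space-link}] ∘ [id_⋎] ∘ [log]` of length 3 from `𝒳_{⋎+1}` to `𝒩⊞_v` in `Γ⃗_{D•⊢}`.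
[cite: MochizukiAbsTopIII2015, Cor 5.5 (iii) p. 131] -/
def postDomP (n : ℤ) (hsl : (LogVertex.spaceLink (isArc v)).isPostLog = false) :
    Path (DVertex.row1 (n + 1) : DVertex Vmod isArc) (.nplus v) :=
  ((Path.nil.cons (DEdge.log n)).cons (DEdge.toCore n)).cons (DEdge.lam v _ hsl)

/-- the path `[λ⊞_{v,ν₂}] ∘ [id_{⋎+1}]` of length 2 from `𝒳_{⋎+1}` to `𝒩⊞_v` in `Γ⃗_{D•⊢}`.
[cite: MochizukiAbsTopIII2015, Cor 5.5 (iii) p. 131] -/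
def postCodP (n : ℤ) (ν : LogVertex (isArc v)) (hν : ν.isPostLog = false) :
    Path (DVertex.row1 (n + 1) : DVertex Vmod isArc) (.nplus v) :=
  (Path.nil.cons (DEdge.toCore (n + 1))).cons (DEdge.lam v ν hν)

/-- Weight of `[λ⊞_{v,ν}]`. [cite: MochizukiAbsTopIII2015, Cor 5.5 (iii) p. 131] -/
theorem pathWt_lamP (ν : LogVertex (isArc v)) (hν : ν.isPostLog = false) :
    DVertex.pathWt (lamP (isArc := isArc) v ν hν) = LogVertex.rank _ ν := by
  show 0 + LogVertex.rank _ ν = _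
  exact Nat.zero_add _

/-- Weight of `[λ⊞_{sl}] ∘ [id_⋎] ∘ [log]`. [cite: MochizukiAbsTopIII2015, Cor 5.5 (iii) p. 131] -/
theorem pathWt_postDomP (n : ℤ) (hsl : (LogVertex.spaceLink (isArc v)).isPostLog = false) :
    DVertex.pathWt (postDomP (isArc := isArc) v n hsl) = 3 + LogVertex.rank _ (LogVertex.spaceLink (isArc v)) := by
  show ((0 + 3) + 0) + LogVertex.rank _ (LogVertex.spaceLink (isArc v)) = _
  omega

/-- Weight of `[λ⊞_{ν₂}] ∘ [id_{⋎+1}]`. [cite: MochizukiAbsTopIII2015, Cor 5.5 (iii) p. 131] -/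
theorem pathWt_postCodP (n : ℤ) (ν₂ : LogVertex (isArc v)) (h₂ : ν₂.isPostLog = false) :
    DVertex.pathWt (postCodP (isArc := isArc) v n ν₂ h₂) = LogVertex.rank _ ν₂ := by
  show (0 + 0) + LogVertex.rank _ ν₂ = _
  omega

/-- The path functor of `[λ⊞_{ν}]` is `Λ_ν ⋙ λ⊞_ν` (`Λ_ν = 𝟭` at a pre-log vertex).
[cite: MochizukiAbsTopIII2015, Def 5.4 (vii) p. 128] -/
theorem pathFunctor_lamP (ν : LogVertex (isArc v)) (hν : ν.isPostLog = false) :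
    L.diagram.pathFunctor (lamP v ν hν) = frobeniusTwist L.log ν.isPostLog ⋙ L.lam v ν := by
  rw [lamP, DiagramOfCategories.pathFunctor_cons, DiagramOfCategories.pathFunctor_nil, hν]
  rfl

/-- … and is `λ⊞_ν` itself (with `𝟭 ⋙ -` removed). [cite: MochizukiAbsTopIII2015, Def 5.4 (vii) p. 128] -/
theorem pathFunctor_lamP' (ν : LogVertex (isArc v)) (hν : ν.isPostLog = false) :
    L.lam v ν = L.diagram.pathFunctor (lamP v ν hν) := by
  rw [lamP, DiagramOfCategories.pathFunctor_cons, DiagramOfCategories.pathFunctor_nil]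
  exact (Functor.id_comp _).symm

/-- The path functor of `[λ⊞_{sl}]∘[id_⋎]∘[log]` is `Λ_{ν₁} ⋙ λ⊞_{ν₁}` for the post-log vertex `ν₁` (`Λ = log`, and
`λ⊞_{sl} = λ⊞_{post-log}` by the proviso of Cor 5.5). [cite: MochizukiAbsTopIII2015, Def 5.4 (vii) p. 128] -/
theorem pathFunctor_postDomP (ν₁ : LogVertex (isArc v)) (h₁ : ν₁.isPostLog = true) (n : ℤ)
    (hsl : (LogVertex.spaceLink (isArc v)).isPostLog = false) :
    L.diagram.pathFunctor (postDomP v n hsl) = frobeniusTwist L.log ν₁.isPostLog ⋙ L.lam v ν₁ := by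
  rw [postDomP, DiagramOfCategories.pathFunctor_cons, DiagramOfCategories.pathFunctor_cons,
    DiagramOfCategories.pathFunctor_cons, DiagramOfCategories.pathFunctor_nil, h₁,
    LogVertex.eq_postLog_of_isPostLog _ h₁, ← L.lam_spaceLink_eq_postLog v]
  rfl

/-- The path functor of `[λ⊞_{ν₂}]∘[id_{⋎+1}]` is `λ⊞_{ν₂}`. [cite: MochizukiAbsTopIII2015, Def 5.4 (vii) p. 128] -/
theorem pathFunctor_postCodP (n : ℤ) (ν₂ : LogVertex (isArc v)) (h₂ : ν₂.isPostLog = false) :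
    L.lam v ν₂ = L.diagram.pathFunctor (postCodP v n ν₂ h₂) := by
  rw [postCodP, DiagramOfCategories.pathFunctor_cons, DiagramOfCategories.pathFunctor_cons,
    DiagramOfCategories.pathFunctor_nil]
  rfl

/-! ## Generators and their homotopies -/

/-- **The generator pairs of Cor 5.5 (iii) in `Γ⃗_{D•⊢}`**: (`pre`) `([λ⊞_{ν₁}], [λ⊞_{ν₂}])` for an `ι⊞`-carrying edge
`ε : ν₁ → ν₂` between pre-log vertices; (`post`) `([λ⊞_{sl}]∘[id_⋎]∘[log], [λ⊞_{ν₂}]∘[id_{⋎+1}])` for an edge out of the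
post-log vertex (abc-iut-f-101's `LogGen`, on the paths of `D•⊢`). [cite: MochizukiAbsTopIII2015, Cor 5.5 (iii) p. 131] -/
inductive LGen : ∀ ⦃c b : DVertex Vmod isArc⦄, Path c b → Path c b → Type u
  | pre (ν₁ ν₂ : LogVertex (isArc v)) (ε : LogEdge (isArc v) ν₁ ν₂) (h₁ : ν₁.isPostLog = false)
      (h₂ : ν₂.isPostLog = false) : LGen (lamP v ν₁ h₁) (lamP v ν₂ h₂)
  | post (ν₁ ν₂ : LogVertex (isArc v)) (ε : LogEdge (isArc v) ν₁ ν₂) (h₁ : ν₁.isPostLog = true)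
      (h₂ : ν₂.isPostLog = false) (hsl : (LogVertex.spaceLink (isArc v)).isPostLog = false) (n : ℤ) :
      LGen (postDomP v n hsl) (postCodP v n ν₂ h₂)

/-- **The prescribed homotopies of the generators**: `ι⊞_{v,ε}`, re-typed along the identifications of the path
functors. [cite: MochizukiAbsTopIII2015, Cor 5.5 (iii) p. 131] -/
noncomputable def lgenHom : ∀ ⦃c b : DVertex Vmod isArc⦄ ⦃g g' : Path c b⦄,
    LGen v g g' → (L.diagram.pathFunctor g ⟶ L.diagram.pathFunctor g')
  | _, _, _, _, LGen.pre ν₁ ν₂ ε h₁ h₂ =>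
    eqToHom (L.pathFunctor_lamP v ν₁ h₁) ≫ L.iota v ε ≫ eqToHom (L.pathFunctor_lamP' v ν₂ h₂)
  | _, _, _, _, LGen.post ν₁ ν₂ ε h₁ h₂ hsl n =>
    eqToHom (L.pathFunctor_postDomP v ν₁ h₁ n hsl) ≫ L.iota v ε ≫ eqToHom (L.pathFunctor_postCodP v n ν₂ h₂)

/-- A generator pair ends at `𝒩⊞_v`. [cite: MochizukiAbsTopIII2015, Cor 5.5 (iii) p. 131] -/
theorem LGen.target_eq {c b : DVertex Vmod isArc} {g g' : Path c b} (s : LGen (isArc := isArc) v g g') :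
    b = .nplus v := by
  cases s <;> rfl

/-! ## Termination: every move lowers the weight -/

/-- **Every move lowers the weight of the path** (f-101's `rank_lt_of_logEdge`, `rank_lt_of_logEdge_post`).
[cite: MochizukiAbsTopIII2015, Cor 5.5 (iii) p. 131] -/
theorem lpathWt_lt_of_move {a b : DVertex Vmod isArc} {p p' : Path a b}
    (m : DiagramOfCategories.Move (LGen (isArc := isArc) v) p p') : DVertex.pathWt p' < DVertex.pathWt p := by
  obtain ⟨c, r, g, g', s, hp, hp'⟩ := m
  cases s with
  | pre ν₁ ν₂ ε h₁ h₂ =>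
    rw [hp, hp', DVertex.pathWt_comp, DVertex.pathWt_comp, pathWt_lamP, pathWt_lamP]
    exact Nat.add_lt_add_left (LogVertex.rank_lt_of_logEdge _ ε h₁) _
  | post ν₁ ν₂ ε h₁ h₂ hsl n =>
    rw [hp, hp', DVertex.pathWt_comp, DVertex.pathWt_comp, pathWt_postDomP, pathWt_postCodP]
    exact Nat.add_lt_add_left (LogVertex.rank_lt_of_logEdge_post _ ε h₁) _

/-- Along a chain of moves the weight does not increase. [cite: MochizukiAbsTopIII2015, Cor 5.5 (iii) p. 131] -/
theorem lpathWt_le_of_chain {a b : DVertex Vmod isArc} {p q : Path a b}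
    (c : DiagramOfCategories.Chain (LGen (isArc := isArc) v) p q) : DVertex.pathWt q ≤ DVertex.pathWt p := by
  induction c with
  | nil p => exact le_rfl
  | cons m rest ih => exact ih.trans (lpathWt_lt_of_move v m).le

/-- A chain with a first move strictly lowers the weight. [cite: MochizukiAbsTopIII2015, Cor 5.5 (iii) p. 131] -/
theorem lpathWt_lt_of_cons {a b : DVertex Vmod isArc} {p p' q : Path a b}
    (m : DiagramOfCategories.Move (LGen (isArc := isArc) v) p p')
    (rest : DiagramOfCategories.Chain (LGen (isArc := isArc) v) p' q) : DVertex.pathWt q < DVertex.pathWt p :=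
  (lpathWt_le_of_chain v rest).trans_lt (lpathWt_lt_of_move v m)

/-! ## Unique decomposition of the paths of `Γ⃗_{D•⊢}` into `𝒩⊞_v` -/

/-- Two presentations `p = [λ⊞_ν] ∘ r = [λ⊞_{ν'}] ∘ r'` have the same last arrow and the same prefix.
[cite: MochizukiAbsTopIII2015, Cor 5.5 (iii) p. 131] -/
theorem eq_of_comp_lamP_eq {a : DVertex Vmod isArc} {r r' : Path a (DVertex.core : DVertex Vmod isArc)}
    {ν ν' : LogVertex (isArc v)} {h : ν.isPostLog = false} {h' : ν'.isPostLog = false}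
    (e : r.comp (lamP v ν h) = r'.comp (lamP v ν' h')) : ν = ν' ∧ r = r' := by
  change r.cons (DEdge.lam v ν h) = r'.cons (DEdge.lam v ν' h') at e
  have hν : (DEdge.lam v ν h : (DVertex.core : DVertex Vmod isArc) ⟶ .nplus v) = DEdge.lam v ν' h' :=
    eq_of_heq (Path.hom_heq_of_cons_eq_cons e)
  have hr : r = r' := eq_of_heq (Path.heq_of_cons_eq_cons e)
  refine ⟨?_, hr⟩
  injection hν

/-- A presentation `[λ⊞_ν] ∘ r = ([λ⊞_{sl}] ∘ [id_⋎] ∘ [log]) ∘ r'` forces `ν = sl` and `r = [id_⋎] ∘ [log] ∘ r'`.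
[cite: MochizukiAbsTopIII2015, Cor 5.5 (iii) p. 131] -/
theorem eq_of_comp_lamP_eq_comp_postDomP {a : DVertex Vmod isArc} {r : Path a (DVertex.core : DVertex Vmod isArc)}
    {ν : LogVertex (isArc v)} {h : ν.isPostLog = false} {n : ℤ}
    {r' : Path a (DVertex.row1 (n + 1) : DVertex Vmod isArc)} {hsl : (LogVertex.spaceLink (isArc v)).isPostLog = false}
    (e : r.comp (lamP v ν h) = r'.comp (postDomP v n hsl)) :
    ν = LogVertex.spaceLink (isArc v) ∧ r = (r'.cons (DEdge.log n)).cons (DEdge.toCore n) := by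
  change r.cons (DEdge.lam v ν h) = ((r'.cons (DEdge.log n)).cons (DEdge.toCore n)).cons (DEdge.lam v _ hsl) at e
  have hν : (DEdge.lam v ν h : (DVertex.core : DVertex Vmod isArc) ⟶ .nplus v) = DEdge.lam v _ hsl :=
    eq_of_heq (Path.hom_heq_of_cons_eq_cons e)
  have hr : r = (r'.cons (DEdge.log n)).cons (DEdge.toCore n) := eq_of_heq (Path.heq_of_cons_eq_cons e)
  refine ⟨?_, hr⟩
  injection hν

/-- Two presentations `([λ⊞_{sl}] ∘ [id_⋎] ∘ [log]) ∘ r = ([λ⊞_{sl}] ∘ [id_{⋎'}] ∘ [log]) ∘ r'` have `⋎ = ⋎'` and `r = r'`.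
[cite: MochizukiAbsTopIII2015, Cor 5.5 (iii) p. 131] -/
theorem eq_of_comp_postDomP_eq {a : DVertex Vmod isArc} {n n' : ℤ}
    {r : Path a (DVertex.row1 (n + 1) : DVertex Vmod isArc)} {r' : Path a (DVertex.row1 (n' + 1) : DVertex Vmod isArc)}
    {hsl hsl' : (LogVertex.spaceLink (isArc v)).isPostLog = false}
    (e : r.comp (postDomP v n hsl) = r'.comp (postDomP v n' hsl')) : n = n' ∧ HEq r r' := by
  change ((r.cons (DEdge.log n)).cons (DEdge.toCore n)).cons (DEdge.lam v _ hsl) =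
    ((r'.cons (DEdge.log n')).cons (DEdge.toCore n')).cons (DEdge.lam v _ hsl') at e
  have e₂ : (r.cons (DEdge.log n)).cons (DEdge.toCore n) = (r'.cons (DEdge.log n')).cons (DEdge.toCore n') :=
    eq_of_heq (Path.heq_of_cons_eq_cons e)
  have hn : (DVertex.row1 n : DVertex Vmod isArc) = DVertex.row1 n' := Path.obj_eq_of_cons_eq_cons e₂
  have hn' : n = n' := by injection hn
  subst hn'
  have e₃ : r.cons (DEdge.log n) = r'.cons (DEdge.log n) := eq_of_heq (Path.heq_of_cons_eq_cons e₂)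
  exact ⟨rfl, Path.heq_of_cons_eq_cons e₃⟩

/-! ## Coherence of the move system -/

/-- `moveHom` is multiplicative in the generator homotopy (composition of two moves with the same prefix).
[cite: MochizukiAbsTopIII2015, Definition 3.5 (ii) p.75] -/
theorem moveHom_comp' {a c b : DVertex Vmod isArc} (r : Path a c) {g g' g'' : Path c b}
    (α : L.diagram.pathFunctor g ⟶ L.diagram.pathFunctor g') (β : L.diagram.pathFunctor g' ⟶ L.diagram.pathFunctor g'')
    {p p' p'' : Path a b} (hp : p = r.comp g) (hp' : p' = r.comp g') (hp'' : p'' = r.comp g'') :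
    L.diagram.moveHom r α hp hp' ≫ L.diagram.moveHom r β hp' hp'' = L.diagram.moveHom r (α ≫ β) hp hp'' := by
  subst hp hp' hp''
  simp only [DiagramOfCategories.moveHom, Category.assoc, eqToHom_trans_assoc, eqToHom_refl, Category.id_comp,
    Functor.whiskerLeft_comp]

/-- **The chain out of `[λ⊞_ν] ∘ r` when `ν` has a unique outgoing edge `ν → ν₃`**: it is empty, or its first move is
the `pre`-move along that edge. [cite: MochizukiAbsTopIII2015, Cor 5.5 (iii) p. 131] -/
theorem chain_from_lamP {a : DVertex Vmod isArc} (r : Path a (DVertex.core : DVertex Vmod isArc))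
    {ν ν₃ : LogVertex (isArc v)} (h : ν.isPostLog = false) (h₃ : ν₃.isPostLog = false) (δ : LogEdge (isArc v) ν ν₃)
    (huniq : ∀ ν₄ : LogVertex (isArc v), LogEdge (isArc v) ν ν₄ → ν₄ = ν₃)
    {q : Path a (DVertex.nplus v)} (c : DiagramOfCategories.Chain (LGen v) (r.comp (lamP v ν h)) q) :
    (∃ e : r.comp (lamP v ν h) = q, c.hom (L.lgenHom v) = eqToHom (by rw [e])) ∨
      ∃ c₂ : DiagramOfCategories.Chain (LGen v) (r.comp (lamP v ν₃ h₃)) q,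
        c.hom (L.lgenHom v) =
          L.diagram.moveHom r (L.lgenHom v (LGen.pre ν ν₃ δ h h₃)) rfl rfl ≫ c₂.hom (L.lgenHom v) := by
  cases c with
  | nil _ => exact Or.inl ⟨rfl, by simp⟩
  | cons m rest =>
    right
    obtain ⟨c, r', g, g', s, hp, hp'⟩ := m
    cases s with
    | pre ν₁ ν₂ ε h₁ h₂ =>
      obtain ⟨rfl, rfl⟩ := eq_of_comp_lamP_eq v hp
      obtain rfl : ν₂ = ν₃ := huniq ν₂ ε
      obtain rfl : ε = δ := LogVertex.logEdge_subsingleton _ ε δ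
      subst hp'
      exact ⟨rest, by rw [DiagramOfCategories.Chain.hom_cons]; rfl⟩
    | post ν₁ ν₂ ε h₁ h₂ hsl n =>
      obtain ⟨rfl, -⟩ := eq_of_comp_lamP_eq_comp_postDomP v hp
      exact ((LogVertex.isEmpty_logEdge_spaceLink _ ν₃).false δ).elim

/-- **The square of generator homotopies commutes** when the `ι⊞`-squares do: for a fork `ν₁ → ν₂`, `ν₁ → ν₂'` closing
into `ν₃`, the two composites of `pre`-moves with a common prefix `r` agree. [cite: MochizukiAbsTopIII2015, Cor 5.5 (iii) p. 131] -/
theorem moveHom_square' (hsq : L.IotaSquaresCommute v) {a : DVertex Vmod isArc}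
    (r : Path a (DVertex.core : DVertex Vmod isArc)) {ν₁ ν₂ ν₂' ν₃ : LogVertex (isArc v)}
    (h₁ : ν₁.isPostLog = false) (h₂ : ν₂.isPostLog = false) (h₂' : ν₂'.isPostLog = false)
    (h₃ : ν₃.isPostLog = false) (ε : LogEdge (isArc v) ν₁ ν₂) (δ : LogEdge (isArc v) ν₂ ν₃)
    (ε' : LogEdge (isArc v) ν₁ ν₂') (δ' : LogEdge (isArc v) ν₂' ν₃) :
    L.diagram.moveHom r (L.lgenHom v (LGen.pre ν₁ ν₂ ε h₁ h₂)) rfl rfl ≫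
        L.diagram.moveHom r (L.lgenHom v (LGen.pre ν₂ ν₃ δ h₂ h₃)) rfl rfl =
      L.diagram.moveHom r (L.lgenHom v (LGen.pre ν₁ ν₂' ε' h₁ h₂')) rfl rfl ≫
        L.diagram.moveHom r (L.lgenHom v (LGen.pre ν₂' ν₃ δ' h₂' h₃)) rfl rfl := by
  rw [moveHom_comp', moveHom_comp']
  congr 1
  ext X₀
  have t₁ : (L.lam v ν₁).obj X₀ = (frobeniusTwist L.log ν₁.isPostLog ⋙ L.lam v ν₁).obj X₀ := by
    simp [frobeniusTwist, h₁]
  have t₂ : (L.lam v ν₂).obj X₀ = (frobeniusTwist L.log ν₂.isPostLog ⋙ L.lam v ν₂).obj X₀ := by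
    simp [frobeniusTwist, h₂]
  have t₂' : (L.lam v ν₂').obj X₀ = (frobeniusTwist L.log ν₂'.isPostLog ⋙ L.lam v ν₂').obj X₀ := by
    simp [frobeniusTwist, h₂']
  have key := hsq h₁ h₂ h₂' h₃ ε δ ε' δ' X₀
    (eqToHom t₁ ≫ (L.iota v ε).app X₀ ≫ eqToHom (rfl : (L.lam v ν₂).obj X₀ = _).symm)
    (eqToHom t₂ ≫ (L.iota v δ).app X₀ ≫ eqToHom (rfl : (L.lam v ν₃).obj X₀ = _).symm)
    (eqToHom t₁ ≫ (L.iota v ε').app X₀ ≫ eqToHom (rfl : (L.lam v ν₂').obj X₀ = _).symm)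
    (eqToHom t₂' ≫ (L.iota v δ').app X₀ ≫ eqToHom (rfl : (L.lam v ν₃).obj X₀ = _).symm)
    ((conj_eqToHom_iff_heq _ _ t₁ rfl).mp rfl) ((conj_eqToHom_iff_heq _ _ t₂ rfl).mp rfl)
    ((conj_eqToHom_iff_heq _ _ t₁ rfl).mp rfl) ((conj_eqToHom_iff_heq _ _ t₂' rfl).mp rfl)
  simp only [eqToHom_refl, Category.comp_id, Category.assoc] at key
  have mid := (cancel_epi _).mp key
  simp only [lgenHom, NatTrans.comp_app, eqToHom_app, Category.assoc, eqToHom_trans_assoc]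
  congr 1
  simp only [← Category.assoc]
  congr 1
  simp only [Category.assoc]
  convert mid using 3 <;> rfl

/-- **COHERENCE of the move system**: if the `ι⊞`-squares of `Γ⃗^log_v` commute, any two chains of moves between the same
two paths of `Γ⃗_{D•⊢}` into `𝒩⊞_v` have the same homotopy (induction on the weight of the source path: the first moves of
two chains out of a path coincide — unique decomposition — unless they form the nonarchimedean fork `𝒪^×_k̄ → {k̄^×, k~}`,
which closes at once into `(k̄^×)^pf` with equal composites). [cite: MochizukiAbsTopIII2015, Cor 5.5 (iii) p. 131] -/
theorem lchain_hom_eq_of_lt (hsq : L.IotaSquaresCommute v) :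
    ∀ (n : ℕ) {a : DVertex Vmod isArc} {p q : Path a (DVertex.nplus v)}
      (c c' : DiagramOfCategories.Chain (LGen v) p q), DVertex.pathWt p < n →
      c.hom (L.lgenHom v) = c'.hom (L.lgenHom v)
  | 0, _, _, _, _, _, h => absurd h (Nat.not_lt_zero _)
  | n + 1, a, p, q, c, c', hlt => by
    have IH : ∀ {p' q' : Path a (DVertex.nplus v)} (d d' : DiagramOfCategories.Chain (LGen v) p' q'),
        DVertex.pathWt p' < DVertex.pathWt p → d.hom (L.lgenHom v) = d'.hom (L.lgenHom v) :=
      fun d d' h => lchain_hom_eq_of_lt hsq n d d' (by omega)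
    cases c with
    | nil _ =>
      cases c' with
      | nil _ => rfl
      | cons m' rest' => exact absurd (lpathWt_lt_of_cons v m' rest') (lt_irrefl _)
    | cons m rest =>
      cases c' with
      | nil _ => exact absurd (lpathWt_lt_of_cons v m rest) (lt_irrefl _)
      | cons m' rest' =>
        rw [DiagramOfCategories.Chain.hom_cons, DiagramOfCategories.Chain.hom_cons]
        obtain ⟨c₁, r₁, g₁, g₁', s₁, hp₁, hp₁'⟩ := m
        obtain ⟨c₂, r₂, g₂, g₂', s₂, hp₂, hp₂'⟩ := m'
        cases s₁ with
        | pre ν₁ ν₂ ε h₁ h₂ =>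
          cases s₂ with
          | pre ν₁' ν₂' ε' h₁' h₂' =>
            obtain ⟨rfl, rfl⟩ := eq_of_comp_lamP_eq v (hp₁.symm.trans hp₂)
            subst hp₁ hp₁' hp₂'
            have hw₂ : DVertex.pathWt (r₁.comp (lamP v ν₂ h₂)) < DVertex.pathWt (r₁.comp (lamP v ν₁ h₁)) := by
              rw [DVertex.pathWt_comp, DVertex.pathWt_comp, pathWt_lamP, pathWt_lamP]
              exact Nat.add_lt_add_left (LogVertex.rank_lt_of_logEdge _ ε h₁) _
            by_cases hν : ν₂ = ν₂'
            · subst hν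
              obtain rfl : ε = ε' := LogVertex.logEdge_subsingleton _ ε ε'
              congr 1
              exact IH rest rest' hw₂
            · obtain ⟨ν₃, δ, δ', -, -, h₃, hrk, hu, hu'⟩ := LogVertex.logEdge_fork _ h₁ ε ε' hν
              have hw₃ : DVertex.pathWt (r₁.comp (lamP v ν₃ h₃)) < DVertex.pathWt (r₁.comp (lamP v ν₁ h₁)) := by
                rw [DVertex.pathWt_comp, DVertex.pathWt_comp, pathWt_lamP, pathWt_lamP]
                exact Nat.add_lt_add_left
                  ((LogVertex.rank_lt_of_logEdge _ δ h₂).trans (LogVertex.rank_lt_of_logEdge _ ε h₁)) _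
              rcases L.chain_from_lamP v r₁ h₂ h₃ δ hu rest with ⟨e, -⟩ | ⟨d₂, hd₂⟩
              · exfalso
                rcases L.chain_from_lamP v r₁ h₂' h₃ δ' hu' rest' with ⟨e', -⟩ | ⟨d₂', -⟩
                · exact hν (eq_of_comp_lamP_eq v (e.trans e'.symm)).1
                · have hw := lpathWt_le_of_chain v d₂'
                  have hw' := LogVertex.rank_lt_of_logEdge _ δ' h₂'
                  rw [← e, DVertex.pathWt_comp, DVertex.pathWt_comp, pathWt_lamP, pathWt_lamP, hrk] at hw
                  omega
              rcases L.chain_from_lamP v r₁ h₂' h₃ δ' hu' rest' with ⟨e', -⟩ | ⟨d₂', hd₂'⟩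
              · exfalso
                have hw := lpathWt_le_of_chain v d₂
                have hw' := LogVertex.rank_lt_of_logEdge _ δ h₂
                rw [← e', DVertex.pathWt_comp, DVertex.pathWt_comp, pathWt_lamP, pathWt_lamP, ← hrk] at hw
                omega
              rw [hd₂, hd₂', ← Category.assoc, ← Category.assoc, IH d₂ d₂' hw₃]
              congr 1
              exact L.moveHom_square' v hsq r₁ h₁ h₂ h₂' h₃ ε δ ε' δ'
          | post ν₁' ν₂' ε' h₁' h₂' hsl' n' =>
            obtain ⟨rfl, -⟩ := eq_of_comp_lamP_eq_comp_postDomP v (hp₁.symm.trans hp₂)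
            exact ((LogVertex.isEmpty_logEdge_spaceLink _ ν₂).false ε).elim
        | post ν₁ ν₂ ε h₁ h₂ hsl k =>
          cases s₂ with
          | pre ν₁' ν₂' ε' h₁' h₂' =>
            obtain ⟨rfl, -⟩ := eq_of_comp_lamP_eq_comp_postDomP v (hp₂.symm.trans hp₁)
            exact ((LogVertex.isEmpty_logEdge_spaceLink _ ν₂').false ε').elim
          | post ν₁' ν₂' ε' h₁' h₂' hsl' k' =>
            obtain ⟨rfl, hr⟩ := eq_of_comp_postDomP_eq v (hp₁.symm.trans hp₂)
            obtain rfl := eq_of_heq hr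
            obtain rfl : ν₁ = ν₁' :=
              (LogVertex.eq_postLog_of_isPostLog _ h₁).trans (LogVertex.eq_postLog_of_isPostLog _ h₁').symm
            obtain rfl : ν₂ = ν₂' := LogVertex.logEdge_post_target_eq _ h₁ ε ε'
            obtain rfl : ε = ε' := LogVertex.logEdge_subsingleton _ ε ε'
            subst hp₁ hp₁' hp₂'
            have hw₂ : DVertex.pathWt (r₁.comp (postCodP v k ν₂ h₂)) < DVertex.pathWt (r₁.comp (postDomP v k hsl)) := by
              rw [DVertex.pathWt_comp, DVertex.pathWt_comp, pathWt_postDomP, pathWt_postCodP]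
              exact Nat.add_lt_add_left (LogVertex.rank_lt_of_logEdge_post _ ε h₁) _
            congr 1
            exact IH rest rest' hw₂

/-- Coherence in the form consumed downstream: any two chains of `ι⊞`-moves between the same two paths of `Γ⃗_{D•⊢}`
into `𝒩⊞_v` have the same homotopy. [cite: MochizukiAbsTopIII2015, Cor 5.5 (iii) p. 131] -/
theorem lchain_hom_eq (hsq : L.IotaSquaresCommute v) {a : DVertex Vmod isArc} {p q : Path a (DVertex.nplus v)}
    (c c' : DiagramOfCategories.Chain (LGen v) p q) : c.hom (L.lgenHom v) = c'.hom (L.lgenHom v) :=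
  L.lchain_hom_eq_of_lt v hsq (DVertex.pathWt p + 1) c c' (Nat.lt_succ_self _)

end LogFrobeniusSetting

end Literature.AnabelianGeometry.AbsoluteAnabelian
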